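import Mathlib

/-!
# Frame cap, elementary proof: a complementary-frame ladder in `F^{2l}` has at most `C(2l, l)` classes

Item `stmt-MatrixMultiplication-14308` (`FourierTwoFamiliesModP.PrimeTwoFamilies`, CKSU 2005 Conj. 4.7 with
prime cyclic hosts), registered stub `frameCap` — the ZONE THEOREM of line Sketch: `r` pairs of `l`-dimensional
subspaces `V c, W c ≤ F^{2l}` with `V c ⊓ W c = ⊥` (diagonal pairs complementary) and `V p ⊔ W q ≠ ⊤` for
`p < q` (lower cross pairs non-spanning) number at most `Nat.choose (2 * l) l`.  This is Lovász's (1977) skew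
version of the Bollobás two-families theorem for subspaces, in the case `dim V + dim W = dim (ambient)`.

This file is a second, EXPLICIT / ELEMENTARY proof (square coordinate determinants and coordinate minors
only — no exterior algebra), independent of `…Theorems.PrimeTwoFamilies.LadderLift.frameCap`.  It contains
no definitions: the three gadgets (block determinant curried in its first block, evaluation functionals,
the minor-vector map) are packaged as existence / inequality lemmas about Mathlib objects.

## Proof

Choose row families `a c : Fin l → F^{2l}` spanning `V c` and `b c : Fin l → F^{2l}` spanning `W c`, and let
`D p q := det [a p ; b q]` be the `2l × 2l` coordinate determinant of the stacked family
`Sum.elim (a p) (b q) : Fin l ⊕ Fin l → F^{2l}` (Mathlib: `Module.Basis.det` of the coordinate basis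
reindexed by `Fin l ⊕ Fin l`).

* `D c c ≠ 0`: `V c ⊓ W c = ⊥` makes the `2l` stacked rows a basis (`det_sumElim_ne_zero`).
* `D p q = 0` for `p < q`: a unit determinant makes the rows span `F^{2l}`, i.e. `V p ⊔ W q = ⊤`
  (`det_sumElim_eq_zero`).

For fixed `b`, `a ↦ det [a ; b]` is an alternating `l`-form on `F^{2l}` (row-linearity and row-alternation
of `det`; `exists_alternating_curry_det`).  Triangularity of `D` makes the `r` forms `a ↦ D(a, b q)` linearly
independent (`linearIndependent_of_triangular`, tested against evaluation at the `a p`).  Finally an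
alternating `k`-form on an `n`-space is determined by its values on the INCREASING basis tuples
`(e_{s₀}, …, e_{s_{k-1}})`, `s` a `k`-subset of the coordinates (values on injective basis tuples determine
it, and sorting a tuple only changes the value by the sign of the sorting permutation), so
`f ↦ (f e_s)_{|s| = k}` embeds the forms into `F^{(n choose k)}` and at most `n.choose k` of them are
independent (`card_le_choose_of_linearIndependent_alternating`); for `a ↦ D(a, b q)` this vector is the
vector of signed maximal minors of the basis matrix of `W q`.  With `n = 2l`, `k = l`: `r ≤ C(2l, l)`.
-/

-- single-conjunct summit: the mandated namespace repeats `MatrixMultiplication` (summit = sub-problem).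
set_option linter.dupNamespace false

namespace Summit.MatrixMultiplication.MatrixMultiplication.Theorems.PrimeTwoFamilies.FrameCapElementary

open Module

section Helpers

variable {F : Type*} [Field F] {M : Type*} [AddCommGroup M] [Module F M]

/-! ### Block determinants `det [a ; b]` of a stacked family `Sum.elim a b` -/

section Blocks

variable {ι ι' : Type*} [Fintype ι] [Fintype ι'] [DecidableEq ι] [DecidableEq ι']

/-- Diagonal pairs: if `a` and `b` are independent families whose spans meet trivially and together have
the cardinality of a basis `e`, then the block determinant `e.det [a ; b]` is nonzero. -/
theorem det_sumElim_ne_zero (e : Basis (ι ⊕ ι') F M) {a : ι → M} {b : ι' → M}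
    (ha : LinearIndependent F a) (hb : LinearIndependent F b)
    (hab : Disjoint (Submodule.span F (Set.range a)) (Submodule.span F (Set.range b))) :
    e.det (Sum.elim a b) ≠ 0 := by
  haveI := Module.Finite.of_basis e
  have hli : LinearIndependent F (Sum.elim a b) := linearIndependent_sum.2 ⟨ha, hb, hab⟩
  have hsp := hli.span_eq_top_of_card_eq_finrank' (Module.finrank_eq_card_basis e).symm
  exact (e.is_basis_iff_det.1 ⟨hli, hsp⟩).ne_zero

/-- Lower cross pairs: if the spans of `a` and `b` together do not fill the space, then the block
determinant `e.det [a ; b]` vanishes. -/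
theorem det_sumElim_eq_zero (e : Basis (ι ⊕ ι') F M) {a : ι → M} {b : ι' → M}
    (h : Submodule.span F (Set.range a) ⊔ Submodule.span F (Set.range b) ≠ ⊤) :
    e.det (Sum.elim a b) = 0 := by
  by_contra hne
  have h2 := e.is_basis_iff_det.2 (isUnit_iff_ne_zero.2 hne)
  rw [Set.Sum.elim_range, Submodule.span_union] at h2
  exact h h2.2

/-- Currying the block determinant: for a fixed second block `b`, the map `a ↦ e.det [a ; b]` is an
alternating form in the first block (row-multilinearity and row-alternation of the determinant). -/
theorem exists_alternating_curry_det (e : Basis (ι ⊕ ι') F M) (b : ι' → M) :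
    ∃ f : M [⋀^ι]→ₗ[F] F, ∀ a, f a = e.det (Sum.elim a b) := by
  refine ⟨{ toFun := fun a => e.det (Sum.elim a b)
            map_update_add' := fun a k x y => ?_
            map_update_smul' := fun a k c x => ?_
            map_eq_zero_of_eq' := fun a i j hij hne => ?_ }, fun a => rfl⟩
  · rw [← Sum.update_elim_inl, ← Sum.update_elim_inl, ← Sum.update_elim_inl,
      AlternatingMap.map_update_add]
  · rw [← Sum.update_elim_inl, ← Sum.update_elim_inl, AlternatingMap.map_update_smul]
  · exact e.det.map_eq_zero_of_eq (Sum.elim a b) (i := Sum.inl i) (j := Sum.inl j)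
      (by simpa using hij) (Sum.inl_injective.ne hne)

end Blocks

/-! ### Triangular families are independent -/

/-- Triangularity forces independence: if linear functionals `T p` satisfy `T c (x c) ≠ 0` and
`T p (x q) = 0` for `p < q`, then the family `x` is linearly independent (test a vanishing combination
with `T q₀`, `q₀` the least index carrying a nonzero coefficient). -/
theorem linearIndependent_of_triangular {U : Type*} [AddCommGroup U] [Module F U] {r : ℕ}
    (x : Fin r → U) (T : Fin r → U →ₗ[F] F) (hdiag : ∀ c, T c (x c) ≠ 0)
    (hupper : ∀ p q : Fin r, p < q → T p (x q) = 0) : LinearIndependent F x := by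
  classical
  rw [Fintype.linearIndependent_iff]
  intro g hg
  by_contra! hne
  obtain ⟨i₀, hi₀⟩ := hne
  obtain ⟨q₀, hq₀, hmin⟩ := Finset.exists_min_image (Finset.univ.filter fun q => g q ≠ 0)
    (fun q => q) ⟨i₀, by simpa using hi₀⟩
  simp only [Finset.mem_filter, Finset.mem_univ, true_and] at hq₀ hmin
  have hsum : ∑ q, T q₀ (g q • x q) = T q₀ (g q₀ • x q₀) := by
    refine Finset.sum_eq_single q₀ (fun q _ hq => ?_) (by simp)
    rcases lt_or_gt_of_ne hq with hlt | hgt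
    · have hq0 : g q = 0 := not_not.1 fun h => (not_le.2 hlt) (hmin q h)
      rw [hq0, zero_smul, map_zero]
    · rw [map_smul, hupper q₀ q hgt, smul_zero]
  have h := congrArg (T q₀) hg
  rw [map_sum, map_zero, hsum, map_smul, smul_eq_zero] at h
  exact h.elim hq₀ (hdiag q₀)

/-! ### At most `n.choose k` independent alternating `k`-forms on an `n`-space -/

/-- An alternating `k`-form vanishing on every INCREASING tuple of basis vectors
`(e s₀, …, e s_{k-1})`, `s₀ < ⋯ < s_{k-1}`, is zero: by multilinearity its values on injective basis tuples
determine it (`Module.Basis.ext_alternating`), and sorting such a tuple changes the value only by the sign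
of the sorting permutation. -/
theorem alternating_eq_zero_of_forall_orderEmbOfFin {n k : ℕ} (e : Basis (Fin n) F M)
    (g : M [⋀^Fin k]→ₗ[F] F)
    (h : ∀ (s : Finset (Fin n)) (hs : s.card = k), g (fun i => e (s.orderEmbOfFin hs i)) = 0) :
    g = 0 := by
  classical
  refine Module.Basis.ext_alternating e fun v hv => ?_
  rw [AlternatingMap.zero_apply]
  -- the image `s` of `v`, a `k`-subset of the index set
  set s : Finset (Fin n) := Finset.univ.image v with hs_def
  have hs : s.card = k := by
    rw [hs_def, Finset.card_image_of_injective _ hv, Finset.card_univ, Fintype.card_fin]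
  have hmem : ∀ i, v i ∈ s := fun i => Finset.mem_image_of_mem v (Finset.mem_univ i)
  -- the permutation sorting `v`: `v = orderEmbOfFin s ∘ σ`
  set τ : Fin k → Fin k := fun i => (s.orderIsoOfFin hs).symm ⟨v i, hmem i⟩ with hτ_def
  have hτv : ∀ i, s.orderEmbOfFin hs (τ i) = v i := fun i => by
    rw [← Finset.coe_orderIsoOfFin_apply, hτ_def, OrderIso.apply_symm_apply]
  have hτ : Function.Injective τ := fun i j hij => hv (by rw [← hτv i, ← hτv j, hij])
  let σ : Equiv.Perm (Fin k) := Equiv.ofBijective τ hτ.bijective_of_finite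
  have hvσ : (fun i => e (v i)) = (fun i => e (s.orderEmbOfFin hs i)) ∘ σ := by
    funext i
    simp only [Function.comp_apply, σ, Equiv.ofBijective_apply, hτv]
  rw [hvσ, AlternatingMap.map_perm, h s hs, smul_zero]

/-- At most `n.choose k` alternating `k`-forms on a space with a basis indexed by `Fin n` are linearly
independent: the linear map `f ↦ (f (e s₀, …, e s_{k-1}))_{|s| = k}` recording the values on increasing
basis tuples is injective (`alternating_eq_zero_of_forall_orderEmbOfFin`) into `F^{(n choose k)}`. -/
theorem card_le_choose_of_linearIndependent_alternating {n k r : ℕ} (e : Basis (Fin n) F M)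
    {f : Fin r → M [⋀^Fin k]→ₗ[F] F} (hf : LinearIndependent F f) : r ≤ n.choose k := by
  let Φ : (M [⋀^Fin k]→ₗ[F] F) →ₗ[F] ({s : Finset (Fin n) // s.card = k} → F) :=
    { toFun := fun g s => g (fun i => e (s.1.orderEmbOfFin s.2 i))
      map_add' := fun _ _ => rfl
      map_smul' := fun _ _ => rfl }
  have hΦ : LinearMap.ker Φ = ⊥ := LinearMap.ker_eq_bot'.2 fun g hg =>
    alternating_eq_zero_of_forall_orderEmbOfFin e g fun s hs => congrFun hg ⟨s, hs⟩
  have h := (hf.map' Φ hΦ).fintype_card_le_finrank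
  simpa only [Fintype.card_fin, Module.finrank_fintype_fun_eq_card, Fintype.card_finset_len] using h

end Helpers

/-- ZONE THEOREM (Lovász 1977, skew Bollobás for subspaces; the case `dim = l + l = 2l`), elementary
determinantal proof: a ladder of `l`-dimensional pairs `(V c, W c)` in `F^{2l}` that is complementary on
the diagonal (`V c ⊓ W c = ⊥`) and non-spanning on lower cross pairs (`V p ⊔ W q ≠ ⊤` for `p < q`) has at
most `Nat.choose (2 * l) l` classes. -/
theorem frameCap {F : Type*} [Field F] {l r : ℕ}
    (V W : Fin r → Submodule F (Fin (2 * l) → F))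
    (hdimV : ∀ c, Module.finrank F (V c) = l) (hdimW : ∀ c, Module.finrank F (W c) = l)
    (hdiag : ∀ c, V c ⊓ W c = ⊥)
    (hcross : ∀ p q : Fin r, p < q → V p ⊔ W q ≠ ⊤) :
    r ≤ (2 * l).choose l := by
  -- (0) row families `a c` spanning `V c` and `b c` spanning `W c`
  have hbasis : ∀ U : Submodule F (Fin (2 * l) → F), Module.finrank F U = l →
      ∃ u : Fin l → Fin (2 * l) → F,
        LinearIndependent F u ∧ Submodule.span F (Set.range u) = U := fun U hU => by
    let bU := Module.finBasisOfFinrankEq F U hU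
    refine ⟨U.subtype ∘ ⇑bU, bU.linearIndependent.map' _ (Submodule.ker_subtype _), ?_⟩
    rw [Set.range_comp, Submodule.span_image, bU.span_eq, Submodule.map_top,
      Submodule.range_subtype]
  choose a hali haspan using fun c => hbasis (V c) (hdimV c)
  choose b hbli hbspan using fun c => hbasis (W c) (hdimW c)
  -- (1) the coordinate basis of `F^{2l}` in two blocks, and the curried block determinants
  --     `f q : a ↦ det [a ; b q]`, alternating `l`-forms on `F^{2l}`
  let e₂ : Basis (Fin l ⊕ Fin l) F (Fin (2 * l) → F) :=
    (Pi.basisFun F (Fin (2 * l))).reindex ((finCongr (two_mul l)).trans finSumFinEquiv.symm)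
  choose f hf using fun q => exists_alternating_curry_det e₂ (b q)
  -- (2) the matrix `D p q := f q (a p) = det [a p ; b q]` is triangular with nonzero diagonal
  have hD1 : ∀ c, f c (a c) ≠ 0 := fun c => by
    rw [hf]
    exact det_sumElim_ne_zero e₂ (hali c) (hbli c)
      (by rw [haspan, hbspan]; exact disjoint_iff.2 (hdiag c))
  have hD0 : ∀ p q : Fin r, p < q → f q (a p) = 0 := fun p q hpq => by
    rw [hf]
    exact det_sumElim_eq_zero e₂ (by rw [haspan, hbspan]; exact hcross p q hpq)
  -- (3) so the `r` forms `f q` are linearly independent (test with evaluation at the `a p`) …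
  have hfi : LinearIndependent F f :=
    linearIndependent_of_triangular f
      (fun p => { toFun := fun g => g (a p), map_add' := fun _ _ => rfl, map_smul' := fun _ _ => rfl })
      hD1 hD0
  -- (4) … and at most `C(2l, l)` alternating `l`-forms on `F^{2l}` are independent
  exact card_le_choose_of_linearIndependent_alternating (Pi.basisFun F (Fin (2 * l))) hfi

end Summit.MatrixMultiplication.MatrixMultiplication.Theorems.PrimeTwoFamilies.FrameCapElementary
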